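import Literature.AlgebraicTopology.SingularHomology.HomologySpheres
import Literature.AlgebraicTopology.SingularHomology.UniversalCoefficientsProofs
import Literature.AlgebraicTopology.SingularHomology.RelativeCapProduct
import Literature.AlgebraicTopology.SingularHomology.ExcisionMayerVietorisProofs
import Literature.AlgebraicTopology.SingularHomology.SphereHomology
import HarnessLib

/-!
# Universal coefficients: the Kronecker map is injective over a free `Hₙ` (discharge of `injective_kroneckerMap_of_free`)

Sibling proof file of `HomologySpheres.lean` (D-0014), which vendors, next to the two universal
coefficient facts of `UniversalCoefficients.lean`, the named fact
`Literature.AlgebraicTopology.SingularHomology.injective_kroneckerMap_of_free R X n`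
(A. Hatcher, *Algebraic Topology* (2002), §3.1, Thm. 3.2, p. 195: the split exact sequence
`0 → Ext(Hₙ(C), G) → Hⁿ⁺¹(C; G) —h→ Hom(Hₙ₊₁(C), G) → 0`; p. 196: "`Ext(H, G) = 0` if `H` is
free"; p. 197: verbatim over a principal ideal domain): if `Hₙ(X; R)` is a free `R`-module then
the Kronecker map `h : Hⁿ⁺¹(X; R) → Hom_R(Hₙ₊₁(X; R), R)` is injective.

It is PROVED here (`injective_kroneckerMap_of_free_holds`), for every principal ideal domain
`R`, every space `X` and every degree `n`, by Hatcher's argument (§3.1, pp. 191–195) exactly as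
in the tree's proof of the torsion statement `ker_kroneckerPairing_le_torsion`
(`UniversalCoefficientsProofs.lean`), the finite-generation/torsion step being replaced by the
vanishing of `Ext` on a free module:

* let `φ` be an `(n+1)`-cocycle with `⟨[φ], -⟩ = 0`, i.e. `φ` vanishes on the cycles `Zₙ₊₁`
  (evaluation formula `kroneckerPairing_π_homologyπ`); then `φ = ψ ∘ ∂` for a functional `ψ` on
  the boundaries `Bₙ = ∂Cₙ₊₁ ⊆ Zₙ`;
* **`Bₙ` is a direct summand of `Zₙ` when `Hₙ = Zₙ/Bₙ` is free** (p. 196, "`Ext(H, G) = 0` if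
  `H` is free", i.e. `0 → Bₙ → Zₙ → Hₙ → 0` splits): the class map `g : Zₙ → Hₙ(X; R)`,
  `z ↦ [z]`, has kernel exactly `Bₙ` (`homologyCls_eq_zero_iff`) and free target, so
  `exists_retraction_ker_of_free` gives a retraction `r : Zₙ → Bₙ`, and `χ = ψ ∘ r` extends `ψ`;
* extend `χ` to `Cₙ` through the retraction `Cₙ → Zₙ` (the splitting of
  `0 → Zₙ → Cₙ → Bₙ₋₁ → 0`, `exists_retraction_ker_of_free` again, `Bₙ₋₁ ⊆ Cₙ₋₁` free by
  Hungerford's Thm. IV.6.1); the resulting `n`-cochain `χ'` has `δχ' = φ` (`evalChain_d`), whence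
  `[φ] = 0`.

Nothing is asserted; no statement of `HomologySpheres.lean` or `UniversalCoefficients.lean` is
modified, and no definition is introduced.

## The sphere is a homology sphere (Hatcher Cor. 2.14)

The predicate `Literature.AlgebraicTopology.SingularHomology.IsHomologySphere M n` of
`HomologySpheres.lean` ("`M` has the integral homology of `Sⁿ`": `Hₖ(M; ℤ) = 0` for
`0 < k ≠ n`, `Hₙ(M; ℤ) ≅ ℤ` — the notion in Milnor, *Lectures on the h-cobordism theorem*
(1965), §9, Prop. B, p. 109) is a definition, not an assertion; this file records its model case
`isHomologySphere_sphere`: the unit sphere `Sⁿ ⊆ ℝⁿ⁺¹ = EuclideanSpace ℝ (Fin (n + 1))`, `n ≥ 1`,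
is a homology `n`-sphere (Hatcher 2002, Cor. 2.14, p. 114: `Hₖ(Sⁿ) = 0` for `0 < k ≠ n`,
`Hₙ(Sⁿ) ≅ ℤ`), assembled from the tree's discharged sphere computations
`isZero_singularHomology_sphere_holds` (`…ExcisionMayerVietorisProofs`) and
`nonempty_singularHomology_sphere_iso_holds` (`…SphereHomology`). (`HomologySpheres.lean` has the
complementary `not_isHomologySphere_of_subsingleton`: a point is not one.)

## References

* A. Hatcher, *Algebraic Topology*, CUP 2002, §3.1: pp. 191–195 (proof of the universal
  coefficient theorem), Thm. 3.2 (p. 195), p. 196 ("`Ext(H, G) = 0` if `H` is free"), p. 197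
  (principal ideal domains), pp. 198–199 (spaces); §2.2 Cor. 2.14 (p. 114). [HatcherAT2002]
* T. W. Hungerford, *Algebra*, GTM 73, Springer 1974, Ch. IV Thm. 6.1. [Hungerford1974]
* J. Milnor, *Lectures on the h-cobordism theorem*, Princeton (1965), §9, Prop. B (p. 109).
  [MilnorHCobordism1965]
-/

noncomputable section

open CategoryTheory Limits Submodule

universe u v

namespace Literature.AlgebraicTopology.SingularHomology

section Injective

variable (R : Type v) [CommRing R] [IsDomain R] [IsPrincipalIdealRing R]
  (X : Type u) [TopologicalSpace X]

open singularChainComplex singularCochainComplex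

/-- **The Kronecker map `h : Hⁿ⁺¹(X; R) → Hom_R(Hₙ₊₁(X; R), R)` is injective when `Hₙ(X; R)` is
free** (Hatcher 2002, §3.1, Thm. 3.2, p. 195: `ker h = Ext(Hₙ, R)`; p. 196: "`Ext(H, G) = 0` if
`H` is free"; p. 197 over a PID), for every space `X`, degree `n` and principal ideal domain `R`.
Proof: an `(n+1)`-cocycle `φ` with `⟨[φ], -⟩ = 0` vanishes on `Zₙ₊₁`, so `φ = ψ ∘ ∂` for a
functional `ψ` on `Bₙ = ∂Cₙ₊₁ ⊆ Zₙ`; the class map `Zₙ → Hₙ(X; R)` has kernel `Bₙ` and free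
target, so `Bₙ` is a retract of `Zₙ` (`exists_retraction_ker_of_free`) and `ψ` extends to `Zₙ`,
then to `Cₙ` through the retraction `Cₙ → Zₙ`; the extension `χ'` is an `n`-cochain with
`δχ' = φ`, so `[φ] = 0`. PROVED. [cite: HatcherAT2002, §3.1 Thm. 3.2 (p. 195) and p. 196] -/
theorem injective_kroneckerPairing_of_free (n : ℕ) [Module.Free R (singularHomology R R X n)] :
    Function.Injective (kroneckerPairing R R X (n + 1)) := by
  refine (injective_iff_map_eq_zero _).mpr fun x hx => ?_
  set K := singularChainComplex R R X with hK
  set j := (ComplexShape.down ℕ).next n with hj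
  set Z : Submodule R (K.X n) := LinearMap.ker (K.d n j).hom with hZ
  have hdd : ∀ c : K.X (n + 1), (K.d (n + 1) n).hom c ∈ Z := fun c => LinearMap.mem_ker.mpr (by
    change (K.d (n + 1) n ≫ K.d n j) c = 0
    rw [K.d_comp_d]
    rfl)
  set dZ : K.X (n + 1) →ₗ[R] Z := (K.d (n + 1) n).hom.codRestrict Z hdd with hdZ
  set B : Submodule R Z := LinearMap.range dZ with hB
  -- the class map `g : Zₙ → Hₙ(X; R)`, `z ↦ [z]`
  have hsub : ModuleCat.ofHom Z.subtype ≫ K.d n j = 0 := by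
    ext z
    exact LinearMap.mem_ker.mp z.2
  set lc : ModuleCat.of R Z ⟶ cycles R R X n :=
    K.liftCycles (ModuleCat.ofHom Z.subtype) j rfl hsub with hlc
  have hlci : ∀ z : Z, iCycles R R X n (lc z) = (z : K.X n) := fun z => by
    change (lc ≫ K.iCycles n) z = (z : K.X n)
    rw [hlc, K.liftCycles_i]
    rfl
  set g : Z →ₗ[R] singularHomology R R X n := (lc ≫ K.homologyπ n).hom with hg
  have hg_apply : ∀ z : Z, g z = K.homologyπ n (lc z) := fun z => rfl
  -- boundaries have zero class …
  have hgB : ∀ c : K.X (n + 1), g (dZ c) = 0 := fun c => by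
    have e : lc (dZ c) = toCycles R R X (n + 1) n c :=
      cycles_ext (by rw [hlci, iCycles_toCycles]; rfl)
    rw [hg_apply, e, homologyπ_toCycles]
  -- … and a cycle with zero class is a boundary
  have hker : ∀ z : Z, g z = 0 → z ∈ B := fun z hz0 => by
    have hz' : K.d n ((ComplexShape.down ℕ).next n) (z : K.X n) = 0 := LinearMap.mem_ker.mp z.2
    have hcls : homologyCls (z : K.X n) hz' = g z := by
      rw [homologyCls_eq_homologyπ_cyclesMk (z : K.X n) hz' j rfl (LinearMap.mem_ker.mp z.2),
        hg_apply]
      congr 1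
      exact cycles_ext (by rw [hlci]; exact K.i_cyclesMk _ _ _ _)
    obtain ⟨w, hw⟩ := (exists_d_prev_eq_iff (i := n + 1) (ChainComplex.prev ℕ n) (z : K.X n)).mp
      ((homologyCls_eq_zero_iff (z : K.X n) hz').mp (hcls.trans hz0))
    exact ⟨w, Subtype.ext hw⟩
  -- `Hₙ` free: `Bₙ = ker g` is a retract of `Zₙ`
  obtain ⟨r, hr₁, hr₂⟩ := exists_retraction_ker_of_free (R := R) g
  let r' : Z →ₗ[R] B := r.codRestrict B fun z => hker _ (hr₁ z)
  have hr' : ∀ b : B, (r' b : Z) = b := fun b => by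
    obtain ⟨c, hc⟩ := b.2
    change r (b : Z) = b
    exact hr₂ _ (by rw [← hc]; exact hgB c)
  -- represent `x` by a cocycle `φ`
  induction x using singularCohomology_induction_on with
  | h φc =>
    set φ : SingularSimplex X (n + 1) → R := iCocycles R R X (n + 1) φc with hφ
    -- `φ` vanishes on `(n+1)`-cycles
    have hE : ∀ c : K.X (n + 1), (K.d (n + 1) n).hom c = 0 →
        (Finsupp.linearCombination R (φ) ∘ₗ (csingularChainComplex.compInv R R X _).hom) c = 0 := by
      intro c hc
      obtain ⟨z, rfl⟩ := exists_cycles_of_d_eq_zero (ChainComplex.next_nat_succ n) c hc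
      rw [hφ, ← kroneckerPairing_π_homologyπ, hx, LinearMap.zero_apply]
    -- `ψ : Bₙ → R` with `ψ (∂c) = φ(c)`
    have hkerψ : LinearMap.ker dZ ≤ LinearMap.ker
        ((Finsupp.linearCombination R (φ) ∘ₗ (csingularChainComplex.compInv R R X _).hom)) := by
      intro c hc
      rw [LinearMap.mem_ker] at hc ⊢
      exact hE c (congrArg Subtype.val hc)
    let ψ : B →ₗ[R] R := (LinearMap.ker dZ).liftQ
        ((Finsupp.linearCombination R (φ) ∘ₗ (csingularChainComplex.compInv R R X _).hom)) hkerψ ∘ₗ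
      dZ.quotKerEquivRange.symm.toLinearMap
    have hψ : ∀ c : K.X (n + 1), ψ ⟨dZ c, LinearMap.mem_range_self dZ c⟩ =
        (Finsupp.linearCombination R (φ) ∘ₗ (csingularChainComplex.compInv R R X _).hom) c := by
      intro c
      change (LinearMap.ker dZ).liftQ
        ((Finsupp.linearCombination R (φ) ∘ₗ (csingularChainComplex.compInv R R X _).hom)) hkerψ
          (dZ.quotKerEquivRange.symm ⟨dZ c, _⟩) = _
      rw [LinearMap.quotKerEquivRange_symm_apply_image, Submodule.mkQ_apply, Submodule.liftQ_apply]
    -- extend `ψ` to `χ : Zₙ → R` through the retraction `r'`, then to `Cₙ` through `p`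
    let χ : Z →ₗ[R] R := ψ ∘ₗ r'
    have hχ : ∀ b : B, χ b = ψ b := fun b => by
      change ψ (r' b) = ψ b
      rw [show r' b = b from Subtype.ext (hr' b)]
    haveI : Module.Free R (K.X j) := free_singularChainComplex_X R j
    obtain ⟨p, hp₁, hp₂⟩ := exists_retraction_ker_of_free (R := R) (K.d n j).hom
    let p' : K.X n →ₗ[R] Z := p.codRestrict Z fun c => LinearMap.mem_ker.mpr (hp₁ c)
    let L : K.X n →ₗ[R] R := χ ∘ₗ p'
    let χ' : SingularSimplex X n → R := fun σ => L (single (R := R) σ 1)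
    have hχ'L : (Finsupp.linearCombination R (χ') ∘ₗ (csingularChainComplex.compInv R R X _).hom) = L :=
      evalChain_apply_single_one L
    have hLd : ∀ c : K.X (n + 1), L ((K.d (n + 1) n).hom c) =
        (Finsupp.linearCombination R (φ) ∘ₗ (csingularChainComplex.compInv R R X _).hom) c := by
      intro c
      have hpc : p' ((K.d (n + 1) n).hom c) = dZ c :=
        Subtype.ext (hp₂ _ (LinearMap.mem_ker.mp (hdd c)))
      change χ (p' ((K.d (n + 1) n).hom c)) = _
      rw [hpc, show dZ c = ((⟨dZ c, LinearMap.mem_range_self dZ c⟩ : B) : Z) from rfl, hχ, hψ]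
    -- `δχ' = φ`
    have hδ : (singularCochainComplex R R X).d n (n + 1) χ' = φ := by
      refine singularCochainComplex.ext fun τ => ?_
      rw [← evalChain_single_one ((singularCochainComplex R R X).d n (n + 1) χ') τ, ← evalChain_d,
        hχ'L]
      change L ((K.d (n + 1) n).hom (single (R := R) τ 1)) = _
      rw [hLd, evalChain_single_one]
    -- hence `[φ] = [δχ'] = 0`
    change singularCohomology.π R R X (n + 1) φc = 0
    have hcyc : φc = toCocycles R R X n (n + 1) χ' := by
      apply (ModuleCat.mono_iff_injective (iCocycles R R X (n + 1))).1 inferInstance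
      change φ = (toCocycles R R X n (n + 1) ≫ iCocycles R R X (n + 1)) χ'
      rw [HomologicalComplex.toCycles_i, hδ]
    rw [hcyc]
    change (toCocycles R R X n (n + 1) ≫ (singularCochainComplex R R X).homologyπ (n + 1)) χ' = 0
    rw [HomologicalComplex.toCycles_comp_homologyπ]
    rfl

/-- **Discharge of the named fact `injective_kroneckerMap_of_free R X n`** (Hatcher 2002,
Thm. 3.2 with p. 196, as vendored in `HomologySpheres.lean`), for every principal ideal domain
`R`, space `X` and degree `n`. [cite: HatcherAT2002, §3.1 Thm. 3.2 (p. 195) and p. 196] -/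
theorem injective_kroneckerMap_of_free_holds (n : ℕ) : injective_kroneckerMap_of_free R X n :=
  fun hF => by
    haveI := hF
    exact injective_kroneckerPairing_of_free R X n

end Injective

/-! ### The unit sphere `Sⁿ`, `n ≥ 1`, is a homology `n`-sphere -/

section Sphere

/-- **The `n`-sphere is a homology `n`-sphere, `n ≥ 1`** (Hatcher 2002, Cor. 2.14, p. 114:
`Hₖ(Sⁿ; ℤ) = 0` for `0 < k ≠ n` and `Hₙ(Sⁿ; ℤ) ≅ ℤ`), for the unit sphere
`Sⁿ = Metric.sphere 0 1 ⊆ EuclideanSpace ℝ (Fin (n + 1))` and the predicate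
`IsHomologySphere` of `HomologySpheres.lean` (the notion of Milnor 1965, §9 Prop. B). From the
tree's discharged named facts `isZero_singularHomology_sphere` and
`nonempty_singularHomology_sphere_iso` (coefficients `R = M = ℤ`). (`S⁰`, two points, is
excluded: `H₀(S⁰; ℤ) ≅ ℤ²`.) [cite: HatcherAT2002, Cor. 2.14 (p. 114)] [cite: MilnorHCobordism1965, §9 Prop. B (p. 109)] -/
theorem isHomologySphere_sphere {n : ℕ} (hn : 1 ≤ n) :
    IsHomologySphere (Metric.sphere (0 : EuclideanSpace ℝ (Fin (n + 1))) 1) n :=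
  ⟨fun _k hk hkn => isZero_singularHomology_sphere_holds ℤ ℤ hk.ne' hkn,
    nonempty_singularHomology_sphere_iso_holds ℤ ℤ hn⟩

/-- The predicate `IsHomologySphere` is inhabited in every dimension `n ≥ 1` (by `Sⁿ`).
[cite: HatcherAT2002, Cor. 2.14 (p. 114)] -/
theorem exists_isHomologySphere {n : ℕ} (hn : 1 ≤ n) :
    ∃ (M : Type) (_ : TopologicalSpace M), IsHomologySphere M n :=
  ⟨_, _, isHomologySphere_sphere hn⟩

end Sphere

end Literature.AlgebraicTopology.SingularHomology

end
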